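import Literature.MathematicalPhysics.PowerSystems.NegativeHessianDirectionInstability
import Literature.MathematicalPhysics.PowerSystems.KuramotoNormalOperationStability
import Literature.MathematicalPhysics.PowerSystems.NonuniformKuramotoDichotomy
import HarnessLib

/-!
# Delabays–Coletta–Jacquod's Theorem 4.1 in its own model: the homogeneous KURAMOTO ring —
# a phase-locked state is stable iff every line has |θᵢ − θⱼ| < π/2 iff it is a twisted state with
# 4|q| < N, for every ring size N ≥ 3

Topic `Literature/MathematicalPhysics/PowerSystems`, namespace
`Literature.MathematicalPhysics.PowerSystems.NonuniformKuramoto`. The tree has the ring dichotomy for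
the damped second-order (swing) model (`ClassicalModel.ringSystem_stable_iff_normalOperation`,
`…_iff_twisted`); the print (DCJ 2016) is about the FIRST-ORDER Kuramoto model
`θ̇ᵢ = P₀ − K Σ_{j ~ i} sin(θᵢ − θⱼ)` on a cycle. This file states and proves the dichotomy for a
non-uniform first-order ring `Dᵢθ̇ᵢ = −Σⱼ Cᵢⱼ sin(θᵢ − θⱼ)` (homogeneous ring weights `C`, zero
natural frequencies after the co-rotating shift, ANY time constants `Dᵢ > 0`), using the same phase
geometry (`ClassicalModel.ringSystem_exists_negativeDirection_of_long_line`, the winding census) and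
gridfusion-lit-2's hypothesis-free Kuramoto unstable clause
(`lockedSolution_unstable_of_negativeDirection`, Lyapunov's indirect method) and exponential-stability
clause (`lockedSolution_locally_expStable_of_normalOperation`). No definition, no named fact, no
axiom: the ring is given by hypotheses on a general `NonuniformKuramoto (n + 1)`.

SOURCES (read this session). R. Delabays, T. Coletta, P. Jacquod, J. Math. Phys. 57 (2016) 032701
[DelabaysColettaJacquod2016] §2 eq. (2.1) (the Kuramoto model on a network, identical frequencies
after the shift), §4.2 **Thm 4.1** (arXiv:1512.04266 p0009 L101–p0010 L58: «single-cycle network …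
any stable solution has all angle differences in [−π/2, π/2] … Δ = 2πq/n»); D. Manik, M. Timme,
D. Witthaut, Chaos 27 (2017) 083123 [ManikTimmeWitthaut2017] §3 Lemma 1 («for both the Kuramoto system
and the power grid model»), §5.4 Thm 12; H. K. Khalil [Khalil2002] Thm 4.7.

## What is proved (`Kur : NonuniformKuramoto (n + 1)` with `Dᵢ > 0`, `ω = 0`, `φ = 0`,
`Pᵢⱼ = K·[j = ρi ∨ i = ρj]`, `N = n + 1 ≥ 3`, `K > 0`)

* §1 bridge: `ring_P_eq_C`, `ring_syncFreq_eq_zero`, `ring_field_eq`, `ring_locked_iff_flow_eq_zero`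
  (phase-locked states of the Kuramoto ring = synchronous states of the swing ring), the quadratic
  identity `sum_mul_sum_linWeight_eq_half`.
* §2 ★★ `ring_lockedSolution_unstable_of_long_line` (a locked state with ONE negative-cosine line is
  an unstable phase-locked solution — every `N`, no nondegeneracy), ★★
  `ring_lockedSolution_expStable_of_normalOperation` (all cosines positive ⇒ locally exponentially
  stable modulo rotation).
* §3 ★★★ **`ring_lockedSolution_stable_iff_normalOperation`**, ★★★
  **`ring_lockedSolution_stable_iff_twisted`**: for a locked state with no line at `|Δθ| = π/2`,
  Lyapunov stability of the locked solution ⇔ every line cosine positive ⇔ twisted with `4|q| < N`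
  up to rotation and whole turns.

THREE COLUMNS. CERTIFIED for MODEL `M` = first-order Kuramoto ring with homogeneous coupling and
identical natural frequencies (co-rotating frame), any `Dᵢ > 0`; «stable» = Lyapunov stability of the
phase-locked solution of `M`. NOT CLAIMED: the states with all lines at `|Δθ| = π/2`; any grid.
-/

noncomputable section

open Real Set Filter Topology Metric Finset
open scoped Matrix

namespace Literature.MathematicalPhysics.PowerSystems

namespace NonuniformKuramoto

variable {n : ℕ} (Kur : NonuniformKuramoto (n + 1)) (K : ℝ)

/-! ### §1. The Kuramoto ring and the swing ring have the same coupling and the same locked states -/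

/-- The coupling of the Kuramoto ring is the coupling matrix of the swing ring `ringSystem`.
[cite: DelabaysColettaJacquod2016, §4.2 (single cycle, `K = b₀`)] -/
theorem ring_P_eq_C
    (hP : ∀ i j, Kur.P i j = if j = finRotate (n + 1) i ∨ i = finRotate (n + 1) j then K else 0) :
    Kur.P = (ClassicalModel.ringSystem n K Kur.D Kur.D).C := by
  funext i j
  rw [hP, ClassicalModel.ringSystem_C]

/-- With zero natural frequencies the synchronous frequency `Σωⱼ/ΣDⱼ` vanishes.
[cite: DelabaysColettaJacquod2016, §2 after eq. (2.2) («we consider … P = Ω1 ≡ 0»)] -/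
theorem ring_syncFreq_eq_zero (hω : ∀ i, Kur.ω i = 0) :
    (∑ j, Kur.ω j) / ∑ j, Kur.D j = 0 := by
  simp [hω]

/-- The Kuramoto ring field is `−flowᵢ(θ)/Dᵢ` with the swing ring's flow.
[cite: DelabaysColettaJacquod2016, §2 eq. (2.2)] -/
theorem ring_field_eq (hω : ∀ i, Kur.ω i = 0)
    (hP : ∀ i j, Kur.P i j = if j = finRotate (n + 1) i ∨ i = finRotate (n + 1) j then K else 0)
    (hφ : ∀ i j, Kur.φ i j = 0) (θ : Fin (n + 1) → ℝ) (i : Fin (n + 1)) :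
    Kur.field θ i = -((ClassicalModel.ringSystem n K Kur.D Kur.D).flow θ i) / Kur.D i := by
  simp only [field, hω, hφ, add_zero, zero_sub, ClassicalModel.LosslessSystem.flow,
    Finset.univ_eq_empty, Finset.sum_empty]
  congr 2
  exact Finset.sum_congr rfl fun j _ => by rw [hP, ClassicalModel.ringSystem_C]

/-- Phase-locked states of the Kuramoto ring (`fieldᵢ(θ) = Σω/ΣD`) are exactly the synchronous states
of the swing ring (`flowₖ(θ) = 0`). [cite: ManikTimmeWitthaut2017, §3 («Both models have the same fixed points»)] -/
theorem ring_locked_iff_flow_eq_zero (hD : ∀ i, 0 < Kur.D i) (hω : ∀ i, Kur.ω i = 0)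
    (hP : ∀ i j, Kur.P i j = if j = finRotate (n + 1) i ∨ i = finRotate (n + 1) j then K else 0)
    (hφ : ∀ i j, Kur.φ i j = 0) (θ : Fin (n + 1) → ℝ) :
    (∀ i, Kur.field θ i = (∑ j, Kur.ω j) / ∑ j, Kur.D j) ↔
      ∀ k, (ClassicalModel.ringSystem n K Kur.D Kur.D).flow θ k = 0 := by
  rw [Kur.ring_syncFreq_eq_zero hω]
  refine forall_congr' fun i => ?_
  rw [Kur.ring_field_eq K hω hP hφ θ i, div_eq_zero_iff, neg_eq_zero]
  exact ⟨fun h => h.resolve_right (hD i).ne', fun h => Or.inl h⟩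

/-- The quadratic identity `Σᵢ vᵢ Σⱼ wᵢⱼ(vᵢ − vⱼ) = ½ΣᵢΣⱼ wᵢⱼ(vᵢ − vⱼ)²` for symmetric `w`.
[folklore] -/
private theorem sum_mul_sum_mul_sub_eq_half {m : ℕ} (w : Fin m → Fin m → ℝ)
    (hw : ∀ i j, w i j = w j i) (v : Fin m → ℝ) :
    ∑ i, v i * ∑ j, w i j * (v i - v j) = 1 / 2 * ∑ i, ∑ j, w i j * (v i - v j) ^ 2 := by
  have e1 : ∑ i, v i * ∑ j, w i j * (v i - v j) = ∑ i, ∑ j, w i j * (v i * (v i - v j)) := by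
    refine Finset.sum_congr rfl fun i _ => ?_
    rw [Finset.mul_sum]
    exact Finset.sum_congr rfl fun j _ => by ring
  have e2 : ∑ i, ∑ j, w i j * (v i * (v i - v j)) = ∑ i, ∑ j, w i j * (v j * (v j - v i)) := by
    rw [Finset.sum_comm]
    exact Finset.sum_congr rfl fun i _ => Finset.sum_congr rfl fun j _ => by rw [hw j i]
  have e3 : ∑ i, ∑ j, w i j * (v i * (v i - v j)) + ∑ i, ∑ j, w i j * (v j * (v j - v i))
      = ∑ i, ∑ j, w i j * (v i - v j) ^ 2 := by
    rw [← Finset.sum_add_distrib]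
    refine Finset.sum_congr rfl fun i _ => ?_
    rw [← Finset.sum_add_distrib]
    exact Finset.sum_congr rfl fun j _ => by ring
  rw [e1]
  linarith

/-! ### §2. The two clauses for the Kuramoto ring -/

/-- ★★ **A phase-locked state of the Kuramoto ring with ONE negative-cosine line is an UNSTABLE
phase-locked solution** (`N ≥ 3`, `K > 0`, any `Dᵢ > 0`; every `N`, no parity or nondegeneracy
hypothesis): there is `ε > 0` such that for every `η > 0` some phase vector `x₁` with
`‖x₁ − θu‖ < η` has all forward motions of the model leave the `ε`-ball around the locked state `θu`.
At a locked state all `|cos|` agree (`ClassicalModel.ringSystem_abs_cos_eq`), the print's test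
vector is a negative direction of the Hesse form
(`ClassicalModel.ringSystem_exists_negativeDirection_of_long_line`), and a negative direction makes
the locked solution unstable (`lockedSolution_unstable_of_negativeDirection`, Khalil Thm 4.7 part 2).
[cite: DelabaysColettaJacquod2016, §4.2 Thm 4.1 and its proof (arXiv:1512.04266 p0009 L116–p0010 L58); ManikTimmeWitthaut2017, §3 Lemma 1; Khalil2002, Theorem 4.7 (part 2)] -/
theorem ring_lockedSolution_unstable_of_long_line (hn : 2 ≤ n) (hK : 0 < K)
    (hD : ∀ i, 0 < Kur.D i) (hω : ∀ i, Kur.ω i = 0)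
    (hP : ∀ i j, Kur.P i j = if j = finRotate (n + 1) i ∨ i = finRotate (n + 1) j then K else 0)
    (hφ : ∀ i j, Kur.φ i j = 0) {θu : Fin (n + 1) → ℝ}
    (hθu : ∀ i, Kur.field θu i = (∑ j, Kur.ω j) / ∑ j, Kur.D j)
    (hneg : ∃ k, Real.cos (θu k - θu (finRotate (n + 1) k)) < 0) :
    ∃ ε > 0, ∀ η > 0, ∃ x₁ : Fin (n + 1) → ℝ, ‖x₁ - θu‖ < η ∧ ∀ θ : ℝ → Fin (n + 1) → ℝ,
      (∀ T : ℝ, ∀ t ∈ Icc 0 T, HasDerivWithinAt θ (Kur.field (θ t)) (Icc 0 T) t) → θ 0 = x₁ →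
      ∃ t : ℝ, 0 ≤ t ∧ ε < ‖θ t - θu‖ := by
  have hflow := (Kur.ring_locked_iff_flow_eq_zero K hD hω hP hφ θu).1 hθu
  -- no cosine vanishes
  obtain ⟨k₀, hk₀⟩ := hneg
  have h0 : ∀ k, Real.cos (θu k - θu (finRotate (n + 1) k)) ≠ 0 := by
    intro k hk
    have h1 := ClassicalModel.ringSystem_abs_cos_eq K Kur.D Kur.D hn hK.ne' hflow k
    have h2 := ClassicalModel.ringSystem_abs_cos_eq K Kur.D Kur.D hn hK.ne' hflow k₀
    rw [hk, abs_zero] at h1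
    rw [← h1, abs_eq_zero] at h2
    exact hk₀.ne h2
  obtain ⟨v, hv⟩ := ClassicalModel.ringSystem_exists_negativeDirection_of_long_line K Kur.D Kur.D
    hn hK hflow h0 ⟨k₀, hk₀⟩
  have hPs : ∀ i j, Kur.P i j = Kur.P j i := by
    intro i j
    rw [Kur.ring_P_eq_C K hP]
    exact ClassicalModel.ringSystem_C_symm K Kur.D Kur.D i j
  -- the negative direction in lit-2's form
  have hneg' : ∑ i, v i * ∑ j, Kur.toDroopNetwork.linWeight θu i j * (v i - v j) < 0 := by
    have hw : ∀ i j, Kur.toDroopNetwork.linWeight θu i j = Kur.toDroopNetwork.linWeight θu j i := by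
      intro i j
      rw [toDroopNetwork_linWeight, toDroopNetwork_linWeight, hPs i j, ← Real.cos_neg, neg_sub]
    rw [sum_mul_sum_mul_sub_eq_half _ hw v]
    have e : ∑ i, ∑ j, Kur.toDroopNetwork.linWeight θu i j * (v i - v j) ^ 2
        = ∑ i, ∑ j, (ClassicalModel.ringSystem n K Kur.D Kur.D).C i j
          * Real.cos (θu i - θu j) * (v i - v j) ^ 2 := by
      refine Finset.sum_congr rfl fun i _ => Finset.sum_congr rfl fun j _ => ?_
      rw [toDroopNetwork_linWeight, Kur.ring_P_eq_C K hP]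
    rw [e]
    exact hv
  have h := Kur.lockedSolution_unstable_of_negativeDirection hD hφ hPs hθu hneg'
  rw [Kur.ring_syncFreq_eq_zero hω] at h
  simpa only [zero_mul, add_zero] using h

/-- ★★ **A phase-locked state of the Kuramoto ring in NORMAL OPERATION is a locally exponentially
STABLE phase-locked solution modulo rotation** (`N ≥ 3`, `K > 0`, any `Dᵢ > 0`): if every line has
`cos(θuₖ − θu_{ρk}) > 0` there are `ρ, k, λ > 0` such that every solution on `[0, T]` with
`‖θ(0) − θu‖ < ρ` satisfies `‖θ(t) − (θu + c𝟙)‖ ≤ k‖θ(0) − (θu + c𝟙)‖e^{−λt}`,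
`c = Σ Dᵢ(θᵢ(0) − θuᵢ)/Σ Dᵢ` (`lockedSolution_locally_expStable_of_normalOperation` on the connected
ring). [cite: ManikTimmeWitthaut2017, §3 Cor. 1 with Lemma 1; DelabaysColettaJacquod2016, §4.2 Thm 4.1] -/
theorem ring_lockedSolution_expStable_of_normalOperation (hK : 0 < K)
    (hD : ∀ i, 0 < Kur.D i) (hω : ∀ i, Kur.ω i = 0)
    (hP : ∀ i j, Kur.P i j = if j = finRotate (n + 1) i ∨ i = finRotate (n + 1) j then K else 0)
    (hφ : ∀ i j, Kur.φ i j = 0) {θu : Fin (n + 1) → ℝ}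
    (hθu : ∀ i, Kur.field θu i = (∑ j, Kur.ω j) / ∑ j, Kur.D j)
    (hno : ∀ k, 0 < Real.cos (θu k - θu (finRotate (n + 1) k))) :
    ∃ ρ > 0, ∃ k > 0, ∃ lam > 0, ∀ (θ : ℝ → Fin (n + 1) → ℝ) (T : ℝ),
      (∀ t ∈ Icc 0 T, HasDerivWithinAt θ (Kur.field (θ t)) (Icc 0 T) t) → ‖θ 0 - θu‖ < ρ →
      ∀ t ∈ Icc 0 T,
        ‖θ t - fun i => θu i + Kur.D ⬝ᵥ (θ 0 - θu) / (∑ i, Kur.D i)‖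
          ≤ k * ‖θ 0 - fun i => θu i + Kur.D ⬝ᵥ (θ 0 - θu) / ∑ i, Kur.D i‖ * Real.exp (-lam * t) := by
  have hPs : ∀ i j, Kur.P i j = Kur.P j i := by
    intro i j
    rw [Kur.ring_P_eq_C K hP]
    exact ClassicalModel.ringSystem_C_symm K Kur.D Kur.D i j
  have hP0 : ∀ i j, i ≠ j → 0 ≤ Kur.P i j := by
    intro i j hij
    rw [Kur.ring_P_eq_C K hP]
    exact ClassicalModel.ringSystem_C_nonneg K Kur.D Kur.D hK.le i j hij
  have hconn : ClassicalModel.CouplingConnected Kur.P := by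
    rw [Kur.ring_P_eq_C K hP]
    exact ClassicalModel.ringSystem_couplingConnected K Kur.D Kur.D hK
  have hcoh : ∀ i j, i ≠ j → 0 < Kur.P i j → 0 < Real.cos (θu i - θu j) := by
    rw [Kur.ring_P_eq_C K hP]
    exact ClassicalModel.ring_normalOperation_of_edges K Kur.D Kur.D hno
  have h := Kur.lockedSolution_locally_expStable_of_normalOperation hD hφ hPs hP0 hconn hθu hcoh
  rw [Kur.ring_syncFreq_eq_zero hω] at h
  simpa only [zero_mul, add_zero] using h

/-! ### §3. THEOREM 4.1 for the Kuramoto ring: stable ⇔ normal operation ⇔ twisted with 4|q| < N -/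

/-- ★★★ **DCJ THEOREM 4.1 FOR THE KURAMOTO RING, every `N ≥ 3`** (`K > 0`, any `Dᵢ > 0`, zero
natural frequencies). For a phase-locked state `θu` with no line at `|θₖ − θ_{ρk}| = π/2 (mod π)` the
following are equivalent: (i) the locked solution `θu` is LYAPUNOV STABLE — for every `ε > 0` some
`δ > 0` such that every forward motion from every phase vector `x₁` with `‖x₁ − θu‖ < δ` stays in
the `ε`-ball around `θu` for all `t ≥ 0` (motions exist from every `x₁`, `exists_globalSolution`);
(ii) NORMAL OPERATION: every line cosine is positive. «For a single-cycle network … any stable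
solution has all angle differences in [−π/2, π/2].»
[cite: DelabaysColettaJacquod2016, §4.2 Thm 4.1 (arXiv:1512.04266 p0009 L101–p0010 L58); ManikTimmeWitthaut2017, §3 Lemma 1 and Cor. 1; Khalil2002, Theorem 4.7 (part 2)] -/
theorem ring_lockedSolution_stable_iff_normalOperation (hn : 2 ≤ n) (hK : 0 < K)
    (hD : ∀ i, 0 < Kur.D i) (hω : ∀ i, Kur.ω i = 0)
    (hP : ∀ i j, Kur.P i j = if j = finRotate (n + 1) i ∨ i = finRotate (n + 1) j then K else 0)
    (hφ : ∀ i j, Kur.φ i j = 0) {θu : Fin (n + 1) → ℝ}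
    (hθu : ∀ i, Kur.field θu i = (∑ j, Kur.ω j) / ∑ j, Kur.D j)
    (h0 : ∀ k, Real.cos (θu k - θu (finRotate (n + 1) k)) ≠ 0) :
    (∀ ε > 0, ∃ δ > 0, ∀ x₁ : Fin (n + 1) → ℝ, ‖x₁ - θu‖ < δ → ∀ θ : ℝ → Fin (n + 1) → ℝ,
      θ 0 = x₁ → (∀ T : ℝ, ∀ t ∈ Icc 0 T, HasDerivWithinAt θ (Kur.field (θ t)) (Icc 0 T) t) →
      ∀ t, 0 ≤ t → ‖θ t - θu‖ < ε)
    ↔ ∀ k, 0 < Real.cos (θu k - θu (finRotate (n + 1) k)) := by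
  constructor
  · intro hst
    by_contra hno
    push Not at hno
    obtain ⟨k, hk⟩ := hno
    have hneg : Real.cos (θu k - θu (finRotate (n + 1) k)) < 0 := lt_of_le_of_ne hk (h0 k)
    obtain ⟨ε, hε, hall⟩ :=
      Kur.ring_lockedSolution_unstable_of_long_line K hn hK hD hω hP hφ hθu ⟨k, hneg⟩
    obtain ⟨δ, hδ, hstay⟩ := hst ε hε
    obtain ⟨x₁, hx₁, hesc⟩ := hall δ hδ
    obtain ⟨θ, hθ0, hθ⟩ := Kur.exists_globalSolution hD x₁
    obtain ⟨t, ht, hfar⟩ := hesc θ hθ hθ0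
    have := hstay x₁ hx₁ θ hθ0 hθ t ht
    linarith
  · intro hno ε hε
    obtain ⟨ρ, hρ, k, hk, lam, hlam, hexp⟩ :=
      Kur.ring_lockedSolution_expStable_of_normalOperation K hK hD hω hP hφ hθu hno
    -- `δ = min ρ (ε / (2k + 2))`
    refine ⟨min ρ (ε / (2 * k + 2)), lt_min hρ (by positivity), fun x₁ hx₁ θ hθ0 hθ t ht => ?_⟩
    have hx₁ρ : ‖x₁ - θu‖ < ρ := lt_of_lt_of_le hx₁ (min_le_left _ _)
    have hx₁ε : ‖x₁ - θu‖ < ε / (2 * k + 2) := lt_of_lt_of_le hx₁ (min_le_right _ _)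
    rw [← hθ0] at hx₁ρ hx₁ε
    have hb := hexp θ t (hθ t) hx₁ρ t ⟨ht, le_rfl⟩
    -- the rotation offset `c` is at most `‖θ 0 − θu‖`
    set c : ℝ := Kur.D ⬝ᵥ (θ 0 - θu) / ∑ i, Kur.D i with hc
    have hDsum : 0 < ∑ i, Kur.D i := Finset.sum_pos (fun i _ => hD i) Finset.univ_nonempty
    have hcle : |c| ≤ ‖θ 0 - θu‖ := by
      rw [hc, abs_div, abs_of_pos hDsum, div_le_iff₀ hDsum]
      calc |Kur.D ⬝ᵥ (θ 0 - θu)| = |∑ i, Kur.D i * (θ 0 - θu) i| := by rfl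
        _ ≤ ∑ i, |Kur.D i * (θ 0 - θu) i| := Finset.abs_sum_le_sum_abs _ _
        _ ≤ ∑ i, Kur.D i * ‖θ 0 - θu‖ := Finset.sum_le_sum fun i _ => by
            rw [abs_mul, abs_of_pos (hD i)]
            exact mul_le_mul_of_nonneg_left
              (by rw [← Real.norm_eq_abs]; exact norm_le_pi_norm _ i) (hD i).le
        _ = ‖θ 0 - θu‖ * ∑ i, Kur.D i := by
            rw [Finset.mul_sum]; exact Finset.sum_congr rfl fun i _ => by ring
    have hconst : ‖(fun _ : Fin (n + 1) => c)‖ = |c| := by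
      rw [pi_norm_const, Real.norm_eq_abs]
    -- triangle inequalities
    have e1 : θ t - θu = (θ t - fun i => θu i + c) + fun _ => c := by
      funext i; simp only [Pi.sub_apply, Pi.add_apply]; ring
    have e2 : (θ 0 - fun i => θu i + c) = (θ 0 - θu) - fun _ => c := by
      funext i; simp only [Pi.sub_apply]; ring
    have h1 : ‖θ t - θu‖ ≤ ‖θ t - fun i => θu i + c‖ + |c| := by
      rw [e1, ← hconst]
      exact (norm_add_le _ _).trans (by rw [hconst])
    have h2 : ‖θ 0 - fun i => θu i + c‖ ≤ ‖θ 0 - θu‖ + |c| := by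
      rw [e2, ← hconst]
      exact norm_sub_le _ _
    have hexp1 : Real.exp (-lam * t) ≤ 1 := by
      rw [Real.exp_le_one_iff]
      nlinarith
    have h3 : ‖θ t - fun i => θu i + c‖ ≤ k * (‖θ 0 - θu‖ + |c|) := by
      refine hb.trans ?_
      calc k * ‖θ 0 - fun i => θu i + c‖ * Real.exp (-lam * t)
          ≤ k * ‖θ 0 - fun i => θu i + c‖ * 1 := by
            apply mul_le_mul_of_nonneg_left hexp1; positivity
        _ ≤ k * (‖θ 0 - θu‖ + |c|) := by rw [mul_one]; exact mul_le_mul_of_nonneg_left h2 hk.le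
    have h4 : ‖θ t - θu‖ ≤ (2 * k + 1) * ‖θ 0 - θu‖ := by nlinarith [norm_nonneg (θ 0 - θu)]
    have h5 : (2 * k + 1) * ‖θ 0 - θu‖ < ε := by
      have h6 : (2 * k + 1) * ‖θ 0 - θu‖ ≤ (2 * k + 2) * ‖θ 0 - θu‖ := by
        nlinarith [norm_nonneg (θ 0 - θu)]
      have h7 : (2 * k + 2) * ‖θ 0 - θu‖ < ε := by
        have := mul_lt_mul_of_pos_left hx₁ε (by positivity : (0 : ℝ) < 2 * k + 2)
        rwa [mul_div_cancel₀ _ (by positivity : (2 : ℝ) * k + 2 ≠ 0)] at this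
      linarith
    linarith

/-- ★★★ **… ⇔ TWISTED WITH `4|q| < N`**: under the same hypotheses the locked solution is Lyapunov
stable iff `θu` is, up to a common rotation and whole turns, a twisted («splay») state
`θⱼ = 2πqj/N` with winding number `4|q| < N` (`ClassicalModel.exists_winding_of_normalOperation`,
`cos_twisted_edge`, `cos_twisted_pos`) — exactly `2⌈N/4⌉ − 1` such states per period and rotation
(`ClassicalModel.ring_normalOperation_census`). «Δ ∈ {2πq/n} … N = 2 Int[n/4] + 1.»
[cite: DelabaysColettaJacquod2016, §4.2 Thm 4.1 with eq. (4.4) and §1 («N = 2 Int[n/4] + 1»); ManikTimmeWitthaut2017, §5.4 Thm 12 and Cor. 4] -/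
theorem ring_lockedSolution_stable_iff_twisted (hn : 2 ≤ n) (hK : 0 < K)
    (hD : ∀ i, 0 < Kur.D i) (hω : ∀ i, Kur.ω i = 0)
    (hP : ∀ i j, Kur.P i j = if j = finRotate (n + 1) i ∨ i = finRotate (n + 1) j then K else 0)
    (hφ : ∀ i j, Kur.φ i j = 0) {θu : Fin (n + 1) → ℝ}
    (hθu : ∀ i, Kur.field θu i = (∑ j, Kur.ω j) / ∑ j, Kur.D j)
    (h0 : ∀ k, Real.cos (θu k - θu (finRotate (n + 1) k)) ≠ 0) :
    (∀ ε > 0, ∃ δ > 0, ∀ x₁ : Fin (n + 1) → ℝ, ‖x₁ - θu‖ < δ → ∀ θ : ℝ → Fin (n + 1) → ℝ,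
      θ 0 = x₁ → (∀ T : ℝ, ∀ t ∈ Icc 0 T, HasDerivWithinAt θ (Kur.field (θ t)) (Icc 0 T) t) →
      ∀ t, 0 ≤ t → ‖θ t - θu‖ < ε)
    ↔ ∃ q : ℤ, 4 * |q| < (n : ℤ) + 1 ∧ ∀ j : Fin (n + 1), ∃ mj : ℤ,
        θu j = θu 0 + ClassicalModel.twistedState n q j + mj * (2 * π) := by
  rw [Kur.ring_lockedSolution_stable_iff_normalOperation K hn hK hD hω hP hφ hθu h0]
  have hflow := (Kur.ring_locked_iff_flow_eq_zero K hD hω hP hφ θu).1 hθu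
  constructor
  · exact ClassicalModel.exists_winding_of_normalOperation K Kur.D Kur.D hn hK hflow
  · rintro ⟨q, hq, hθ⟩ k
    obtain ⟨mk, hmk⟩ := hθ k
    obtain ⟨mk', hmk'⟩ := hθ (finRotate (n + 1) k)
    have e : θu k - θu (finRotate (n + 1) k)
        = (ClassicalModel.twistedState n q k - ClassicalModel.twistedState n q (finRotate (n + 1) k))
          + ((mk - mk' : ℤ) : ℝ) * (2 * π) := by
      rw [hmk, hmk']
      push_cast
      ring
    rw [e, Real.cos_add_int_mul_two_pi, ClassicalModel.cos_twisted_edge]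
    exact ClassicalModel.cos_twisted_pos hq

end NonuniformKuramoto

end Literature.MathematicalPhysics.PowerSystems

end
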